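import Summits.HubbardSuperconductivity.HubbardSuperconductivity.Theorems.DWavePolarisedDiscordance.Negative.EtaTowerDoublonSums
import Summits.HubbardSuperconductivity.HubbardSuperconductivity.Theorems.NoOnsiteODLRO.Negative.FalseWithoutGroundState
import Summits.HubbardSuperconductivity.HubbardSuperconductivity.Theorems.LiebTwinTwinOnsiteCondensationAttractiveTwin
import Literature.MathematicalPhysics.QuantumLattice.HubbardLiebTwoHoppingsSector

/-!
# Crux `DWavePolarisedDiscordance` (K3′, stmt-HubbardSuperconductivity-15314, route `LiebTwin`) —
# negative-side toolkit II: rectification orders of the staggered `η`-tower (the extremal discordant state)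

Second of three files (see `EtaTowerDoublonSums`, `FalseWithoutMinimality`). For the scaled tower
`φ = c (η_ε†)^n|0⟩` on the torus `(ℤ/Lℤ)²`:

* `cfcAbs_liebW_smul_etaPairingState` — `|W(φ)| = CFC.abs (liebW n φ) = ‖c‖ n! · 1`: rectification of the
  Lieb matrix `n!·diag(±1)` forgets the sign structure completely; the twin is `‖c‖ n! · liebVec n 1`, the
  UNSTAGGERED doublon condensate;
* `re_expect_pairField_sWave_twin_smul_etaPairingState` — `F_s(φ̃) = 2n(L² - n + 1)‖φ‖²`, Yang's maximum
  (the twin pair-order identity with vanishing commutators);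
* `expect_etaPairOne_staggeredTower`, `re_expect_pairField_sWave_smul_staggeredTower_le` — for the STAGGERED
  tower on the even torus `⟨ψ, η₁†η₁ ψ⟩ = ((k+1) - L²Y)⟨ψ,ψ⟩` (`Y = yangPairAmplitude L² (k+1) ≥ 0`), hence
  `F_s(φ) ≤ 2n` for `‖φ‖ = 1`: the momentum-`π` condensate has only `O(L²)` momentum-`0` pair order, so the
  discordance mass `F_s(φ̃) - F_s(φ) ≥ 2n(L² - n)` is macroscopic (uses the sublattice balance `Σ_x ε_x = 0`,
  `sum_torusStagger_eq_zero`);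
* `expect_pairField_twin_smul_etaPairingState_eq` — for every bond form factor (`g 0 = 0`, e.g.
  `dWaveFormFactor`, `extendedSWave`) `⟨φ̃, Δ_gᴴΔ_g φ̃⟩ = ⟨φ, Δ_gᴴΔ_g φ⟩`: the d-wave rectification gain of the
  tower vanishes identically (disjoint supports; weights `n! ε_S` and `n! σ(S,S)` have equal moduli).

Sources: C. N. Yang, PRL **63** (1989) 2144, eqs. (4)–(11); C. N. Yang, S. C. Zhang, Mod. Phys. Lett. B **4**
(1990) 759, §4; E. H. Lieb, PRL **62** (1989) 1201; D. J. Scalapino, Phys. Rep. **250** (1995) 329, §2.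
Elementary; no definition is introduced.
-/

noncomputable section

-- the mandated namespace repeats `HubbardSuperconductivity` (single-problem summit, D-0017)
set_option linter.dupNamespace false

namespace Summit.HubbardSuperconductivity.HubbardSuperconductivity.Theorems.DWavePolarisedDiscordance.Negative

open Matrix Finset Literature.MathematicalPhysics.QuantumLattice Literature.Probability.LatticeModels
open Summit.HubbardSuperconductivity.HubbardSuperconductivity.Theorems.NoOnsiteODLRO.Negative
  (isInSector_etaPairingState)
open Summit.HubbardSuperconductivity.HubbardSuperconductivity.Theorems.TwSeededEnsembleEquivalence.ExposedDensity
  (etaTower_pairField_conjTranspose_mul_self)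
open scoped ComplexOrder

/-! ### Lieb matrix, twin and on-site pair order of the (staggered) tower -/

section Tower

variable {Λ : Type*} [LinearOrder Λ] [Fintype Λ] [DecidableEq Λ]

omit [DecidableEq Λ] in
/-- Yang's diagonal pair amplitude (double occupancy) of the tower:
`⟨ψ, n_{z↑} n_{z↓} ψ⟩ = ((k+1)!)² C(|Λ|-1, k)`, `ψ = (η_ε†)^{k+1}|0⟩`. Yang, PRL 63 (1989) 2144, eq. (9). [folklore] -/
theorem pairAmplitude_self_etaPairingState_succ (ε : Λ → ℤˣ) (k : ℕ) (z : Λ) :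
    pairAmplitude z z (etaPairingState ε (k + 1)) =
      ((k + 1).factorial : ℂ) ^ 2 * (((Fintype.card Λ - 1).choose k : ℕ) : ℂ) := by
  rw [pairAmplitude_eq_star_mulVec_dotProduct, etaPairingState_eq_sum, mulVec_smul,
    pairAnnihilation_mulVec_doublonSum_succ, smul_smul, star_smul_dotProduct_smul,
    star_doublonSum_dotProduct, inter_self, card_powersetCard, card_erase_of_mem (mem_univ z),
    card_univ, star_mul, star_natCast, star_intCast]
  have hz : ((ε z : ℤ) : ℂ) * ((ε z : ℤ) : ℂ) = 1 := by
    rcases Int.units_eq_one_or (ε z) with h | h <;> simp [h]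
  linear_combination
    (((k + 1).factorial : ℂ) ^ 2 * (((Fintype.card Λ - 1).choose k : ℕ) : ℂ)) * hz

omit [DecidableEq Λ] in
/-- Total double occupancy of the tower: `Σ_z ⟨ψ, n_{z↑}n_{z↓} ψ⟩ = (k+1) ⟨ψ, ψ⟩` (every particle is
paired). Yang, PRL 63 (1989) 2144, eq. (9). [folklore] -/
theorem sum_pairAmplitude_self_etaPairingState_succ [Nonempty Λ] (ε : Λ → ℤˣ) (k : ℕ) :
    ∑ z : Λ, pairAmplitude z z (etaPairingState ε (k + 1)) =
      ((k + 1 : ℕ) : ℂ) * (star (etaPairingState ε (k + 1)) ⬝ᵥ etaPairingState ε (k + 1)) := by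
  simp only [pairAmplitude_self_etaPairingState_succ, Finset.sum_const, card_univ, nsmul_eq_mul]
  rw [star_etaPairingState_dotProduct_self]
  obtain ⟨M, hM⟩ : ∃ M, Fintype.card Λ = M + 1 :=
    ⟨Fintype.card Λ - 1, (Nat.succ_pred_eq_of_pos Fintype.card_pos).symm⟩
  rw [hM, Nat.add_sub_cancel]
  have h : ((M + 1 : ℕ) : ℂ) * ((M.choose k : ℕ) : ℂ) =
      (((M + 1).choose (k + 1) : ℕ) : ℂ) * ((k + 1 : ℕ) : ℂ) := by
    exact_mod_cast Nat.add_one_mul_choose_eq M k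
  push_cast at h ⊢
  linear_combination (((k + 1).factorial : ℂ)) ^ 2 * h

omit [DecidableEq Λ] in
/-- `⟨ψ, η₁†η₁ ψ⟩ = Σ_x Σ_y ⟨ψ, c†_{x↑}c†_{x↓}c_{y↓}c_{y↑} ψ⟩` for the UNSTAGGERED `η₁ = Σ_x c_{x↓}c_{x↑}`.
Yang–Zhang, Mod. Phys. Lett. B 4 (1990) 759, §4. [folklore] -/
theorem expect_etaRaise_mul_etaLower_one_eq_sum (ψ : Fock (Orb Λ)) :
    expect (etaRaise (fun _ : Λ => (1 : ℤˣ)) * etaLower (fun _ => 1)) ψ =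
      ∑ x : Λ, ∑ y : Λ, pairAmplitude x y ψ := by
  rw [← EtaPairingODLRO.sum_sum_twoParticleRDM_eq_expect]
  simp [pairAmplitude_eq_twoParticleRDM]

open scoped MatrixOrder Matrix.Norms.L2Operator in
/-- **`|W| = ‖c‖ n! · 1` for the (scaled) tower**: its Lieb matrix `c W_ε`, `W_ε = n! diag(σ(α,α) ε_α)`,
satisfies `(cW)ᴴ(cW) = (‖c‖ n!)² 1`, so `CFC.abs (c W_ε) = ‖c‖ n! · 1` (`CFC.abs a = CFC.sqrt (a⋆a)` and
`CFC.sqrt (b b) = b` for `b ⪰ 0`). The rectified Lieb matrix forgets the sign structure completely. [folklore] -/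
theorem cfcAbs_liebW_smul_etaPairingState (ε : Λ → ℤˣ) (n : ℕ) (c : ℂ) :
    CFC.abs (liebW n (c • etaPairingState ε n)) =
      ((‖c‖ * n.factorial : ℝ) : ℂ) • (1 : Matrix (Config Λ n) (Config Λ n) ℂ) := by
  have hr : (0 : ℂ) ≤ ((‖c‖ * n.factorial : ℝ) : ℂ) := Complex.zero_le_real.2 (by positivity)
  have hQ : (((‖c‖ * n.factorial : ℝ) : ℂ) • (1 : Matrix (Config Λ n) (Config Λ n) ℂ)).PosSemidef :=
    Matrix.PosSemidef.one.smul hr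
  have hmul : star (liebW n (c • etaPairingState ε n)) * liebW n (c • etaPairingState ε n) =
      (((‖c‖ * n.factorial : ℝ) : ℂ) • (1 : Matrix (Config Λ n) (Config Λ n) ℂ)) *
        (((‖c‖ * n.factorial : ℝ) : ℂ) • (1 : Matrix (Config Λ n) (Config Λ n) ℂ)) := by
    rw [liebW_smul, star_smul, smul_mul_smul_comm, star_liebW_mul_liebW_etaPairingState, smul_smul,
      smul_mul_smul_comm, one_mul]
    congr 1
    rw [Complex.star_def, Complex.conj_mul']
    push_cast
    ring
  rw [CFC.abs, hmul, CFC.sqrt_mul_self _ hQ.nonneg]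

variable {L : ℕ} [NeZero L]

/-- The two sublattices of the even torus balance: `Σ_x ε_x = 0` for the staggering sign
(`LiebTwoHoppings.two_mul_card_filter_torusStagger_eq_one`). Lieb, PRL 62 (1989) 1201 (`|A| = |B|`). [folklore] -/
theorem sum_torusStagger_eq_zero (hL : Even L) :
    ∑ x : FermionTorus 2 L, ((torusStagger x : ℤ) : ℂ) = 0 := by
  have hcard := LiebTwoHoppings.two_mul_card_filter_torusStagger_eq_one (L := L) hL
  rw [← Finset.sum_filter_add_sum_filter_not (univ : Finset (FermionTorus 2 L))
    (fun x => torusStagger x = 1) (fun x => ((torusStagger x : ℤ) : ℂ))]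
  have h1 : ∑ x ∈ univ.filter (fun x : FermionTorus 2 L => torusStagger x = 1),
      ((torusStagger x : ℤ) : ℂ) = ((univ.filter fun x : FermionTorus 2 L => torusStagger x = 1).card : ℂ) := by
    rw [Finset.sum_congr rfl (g := fun _ => (1 : ℂ)) fun x hx => by rw [(mem_filter.1 hx).2]; simp,
      sum_const, nsmul_eq_mul, mul_one]
  have h2 : ∑ x ∈ univ.filter (fun x : FermionTorus 2 L => ¬torusStagger x = 1),
      ((torusStagger x : ℤ) : ℂ) = -((univ.filter fun x : FermionTorus 2 L => ¬torusStagger x = 1).card : ℂ) := by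
    rw [Finset.sum_congr rfl (g := fun _ => (-1 : ℂ)) fun x hx => by
        rw [(Int.units_eq_one_or (torusStagger x)).resolve_left (mem_filter.1 hx).2]; simp,
      sum_const, nsmul_eq_mul, mul_neg_one]
  have h3 := Finset.card_filter_add_card_filter_not (s := (univ : Finset (FermionTorus 2 L)))
    (fun x => torusStagger x = 1)
  rw [card_univ, card_fermionTorus] at h3
  rw [h1, h2]
  have h3' : ((univ.filter fun x : FermionTorus 2 L => torusStagger x = 1).card : ℂ) +
      ((univ.filter fun x : FermionTorus 2 L => ¬torusStagger x = 1).card : ℂ) = ((L ^ 2 : ℕ) : ℂ) := by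
    exact_mod_cast h3
  have hc' : (2 : ℂ) * ((univ.filter fun x : FermionTorus 2 L => torusStagger x = 1).card : ℂ) =
      ((L ^ 2 : ℕ) : ℂ) := by
    exact_mod_cast hcard
  linear_combination hc' - h3'

/-- `Σ_x Σ_{y ≠ x} ε_x ε_y = (Σ_x ε_x)² - Σ_x ε_x² = -L²` on the even torus. [folklore] -/
theorem sum_sum_erase_torusStagger (hL : Even L) :
    ∑ x : FermionTorus 2 L, ∑ y ∈ univ.erase x,
        ((torusStagger x : ℤ) : ℂ) * ((torusStagger y : ℤ) : ℂ) = -((L : ℂ) ^ 2) := by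
  have h : ∀ x : FermionTorus 2 L,
      ∑ y ∈ univ.erase x, ((torusStagger x : ℤ) : ℂ) * ((torusStagger y : ℤ) : ℂ) = -1 := by
    intro x
    rw [← Finset.mul_sum, Finset.sum_erase_eq_sub (mem_univ x), sum_torusStagger_eq_zero hL, zero_sub,
      mul_neg]
    rcases Int.units_eq_one_or (torusStagger x) with h | h <;> simp [h]
  simp only [h, sum_const, card_univ, card_fermionTorus, smul_neg, nsmul_eq_mul, mul_one]
  push_cast
  ring

/-- **Unstaggered pair number of the STAGGERED tower.** On the even torus,
`⟨ψ, η₁†η₁ ψ⟩ = ((k+1) - L²·Y) ⟨ψ, ψ⟩` for `ψ = (η_π†)^{k+1}|0⟩`, `Y = yangPairAmplitude L² (k+1) ≥ 0`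
(diagonal: every particle paired; off-diagonal: Yang's constant amplitude `ε_xε_y Y ⟨ψ,ψ⟩` summed against
`Σ_{x≠y} ε_xε_y = -L²`). The momentum-`π` condensate carries only `O(L²)` momentum-`0` pair order.
Yang, PRL 63 (1989) 2144, eqs. (9)–(11). [folklore] -/
theorem expect_etaPairOne_staggeredTower (hL : Even L) (k : ℕ) :
    expect (etaRaise (fun _ : FermionTorus 2 L => (1 : ℤˣ)) * etaLower (fun _ => 1))
        (etaPairingState torusStagger (k + 1)) =
      ((((k + 1 : ℕ) : ℝ) - (L : ℝ) ^ 2 * yangPairAmplitude (L ^ 2) (k + 1) : ℝ) : ℂ) *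
        (star (etaPairingState (torusStagger (d := 2) (L := L)) (k + 1)) ⬝ᵥ
          etaPairingState torusStagger (k + 1)) := by
  rw [expect_etaRaise_mul_etaLower_one_eq_sum]
  have hsplit : ∀ x : FermionTorus 2 L,
      ∑ y, pairAmplitude x y (etaPairingState torusStagger (k + 1)) =
        pairAmplitude x x (etaPairingState torusStagger (k + 1)) +
          ∑ y ∈ univ.erase x, pairAmplitude x y (etaPairingState torusStagger (k + 1)) :=
    fun x => (Finset.add_sum_erase _ _ (mem_univ x)).symm
  simp only [hsplit, Finset.sum_add_distrib]
  rw [sum_pairAmplitude_self_etaPairingState_succ]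
  have hoff : ∀ x : FermionTorus 2 L,
      ∑ y ∈ univ.erase x, pairAmplitude x y (etaPairingState torusStagger (k + 1)) =
        (∑ y ∈ univ.erase x, ((torusStagger x : ℤ) : ℂ) * ((torusStagger y : ℤ) : ℂ)) *
          (((yangPairAmplitude (L ^ 2) (k + 1) : ℝ) : ℂ) *
            (star (etaPairingState (torusStagger (d := 2) (L := L)) (k + 1)) ⬝ᵥ
              etaPairingState torusStagger (k + 1))) := by
    intro x
    rw [Finset.sum_mul]
    refine Finset.sum_congr rfl fun y hy => ?_
    rw [pairAmplitude_etaPairingState torusStagger (k + 1) (ne_of_mem_erase hy).symm, card_fermionTorus]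
    push_cast
    ring
  simp only [hoff]
  rw [← Finset.sum_mul, sum_sum_erase_torusStagger hL]
  push_cast
  ring

/-- Yang's constant is nonnegative for `m ≤ M`. Yang, PRL 63 (1989) 2144, eq. (10). [folklore] -/
theorem yangPairAmplitude_nonneg {M m : ℕ} (h : m ≤ M) : 0 ≤ yangPairAmplitude M m := by
  unfold yangPairAmplitude
  apply div_nonneg
  · exact mul_nonneg (Nat.cast_nonneg _) (sub_nonneg.2 (by exact_mod_cast h))
  · rcases Nat.eq_zero_or_pos M with rfl | hM
    · simp
    · exact mul_nonneg (Nat.cast_nonneg _) (sub_nonneg.2 (by exact_mod_cast hM))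

/-- **On-site pair order of the staggered tower is `O(L²)`.** For the normalised `φ = c (η_π†)^{k+1}|0⟩`
on the even torus, `F_s(φ) = Re⟨φ, Δ_sᴴΔ_s φ⟩ = 2((k+1) - L²Y) ≤ 2(k+1)` (`Δ_sᴴΔ_s = 2η₁†η₁`).
Yang, PRL 63 (1989) 2144, eqs. (9)–(11); Scalapino, Phys. Rep. 250 (1995) 329, §2. [folklore] -/
theorem re_expect_pairField_sWave_smul_staggeredTower_le (hL : Even L) (k : ℕ) (hk : k + 1 ≤ L ^ 2)
    {c : ℂ} (hc : star (c • etaPairingState (torusStagger (d := 2) (L := L)) (k + 1)) ⬝ᵥ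
      (c • etaPairingState torusStagger (k + 1)) = 1) :
    (expect ((pairField sWave L)ᴴ * pairField sWave L)
        (c • etaPairingState (torusStagger (d := 2) (L := L)) (k + 1))).re ≤ 2 * ((k + 1 : ℕ) : ℝ) := by
  rw [etaTower_pairField_conjTranspose_mul_self, Literature.MathematicalPhysics.QuantumLattice.expect_smul,
    EtaPairingODLRO.expect_smul_vec, expect_etaPairOne_staggeredTower hL k]
  rw [star_smul_dotProduct_smul] at hc
  rw [mul_left_comm (star c * c), hc, mul_one]
  have hY := yangPairAmplitude_nonneg hk
  have h2 : ((2 : ℂ) * ((((k + 1 : ℕ) : ℝ) - (L : ℝ) ^ 2 * yangPairAmplitude (L ^ 2) (k + 1) : ℝ) : ℂ)).re =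
      2 * (((k + 1 : ℕ) : ℝ) - (L : ℝ) ^ 2 * yangPairAmplitude (L ^ 2) (k + 1)) := by
    rw [← Complex.ofReal_ofNat, ← Complex.ofReal_mul, Complex.ofReal_re]
  rw [h2]
  nlinarith [mul_nonneg (sq_nonneg (L : ℝ)) hY]

open scoped MatrixOrder Matrix.Norms.L2Operator in
/-- **On-site pair order of the twin is Yang's maximum.** The twin `φ̃ = liebVec n |W(φ)|` of the scaled
tower `φ = c (η_ε†)^n|0⟩` has `|W| = ‖c‖ n! · 1`, whose commutators with every `c†_y c_x` vanish, so the twin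
pair-order identity gives `F_s(φ̃) = 2n(L² - n + 1) ‖φ‖²`. Yang, PRL 63 (1989) 2144, eq. (11);
Lieb, PRL 62 (1989) 1201. [folklore] -/
theorem re_expect_pairField_sWave_twin_smul_etaPairingState (ε : FermionTorus 2 L → ℤˣ) (n : ℕ) (c : ℂ) :
    (expect ((pairField sWave L)ᴴ * pairField sWave L)
        (liebVec n (CFC.abs (liebW n (c • etaPairingState ε n))))).re =
      2 * ((n : ℝ) * ((L : ℝ) ^ 2 - n + 1)) *
        (star (c • etaPairingState ε n) ⬝ᵥ (c • etaPairingState ε n)).re := by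
  rw [LiebTwinTwin.re_expect_pairField_sWave_twin_eq ((isInSector_etaPairingState ε n).smul c),
    cfcAbs_liebW_smul_etaPairingState]
  simp

open scoped MatrixOrder Matrix.Norms.L2Operator in
/-- **The bond pair orders of the tower and of its twin coincide.** For a pair field with no on-site
component (`g 0 = 0`, e.g. `dWaveFormFactor`) on a torus of side `L ≥ 2`:
`⟨φ̃, Δ_gᴴΔ_g φ̃⟩ = ⟨φ, Δ_gᴴΔ_g φ⟩` for `φ = c (η_ε†)^n|0⟩`, `φ̃ = liebVec n |W(φ)| = ‖c‖ n! liebVec n 1`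
(both are doublon sums whose weights `n! ε_S`, resp. `n! σ(S,S)`, have equal moduli; disjoint supports).
Scalapino, Phys. Rep. 250 (1995) 329, §2. [folklore] -/
theorem expect_pairField_twin_smul_etaPairingState_eq [Fact (1 < L)] {g : Site 2 → ℝ} (hg : g 0 = 0)
    (ε : FermionTorus 2 L → ℤˣ) (n : ℕ) (c : ℂ) :
    expect ((pairField g L)ᴴ * pairField g L)
        (liebVec n (CFC.abs (liebW n (c • etaPairingState ε n)))) =
      expect ((pairField g L)ᴴ * pairField g L) (c • etaPairingState ε n) := by
  rw [cfcAbs_liebW_smul_etaPairingState, liebVec_smul, EtaPairingODLRO.expect_smul_vec,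
    EtaPairingODLRO.expect_smul_vec]
  have hsum : etaPairingState ε n = ∑ S ∈ powersetCard n (univ : Finset (FermionTorus 2 L)),
      ((n.factorial : ℂ) * ∏ x ∈ S, ((ε x : ℤ) : ℂ)) • Pi.single (pairSet S S) (1 : ℂ) := by
    rw [etaPairingState_eq_sum, Finset.smul_sum]
    simp_rw [smul_smul]
  have hone : (n.factorial : ℂ) • liebVec n (1 : Matrix (Config (FermionTorus 2 L) n) (Config (FermionTorus 2 L) n) ℂ) =
      ∑ S ∈ powersetCard n (univ : Finset (FermionTorus 2 L)),
        ((n.factorial : ℂ) * pairSign S S) • Pi.single (pairSet S S) (1 : ℂ) := by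
    rw [liebVec_one_eq_sum, Finset.smul_sum]
    simp_rw [smul_smul]
  have h1 : expect ((pairField g L)ᴴ * pairField g L) (etaPairingState ε n) =
      (n.factorial : ℂ) ^ 2 *
        expect ((pairField g L)ᴴ * pairField g L)
          (liebVec n (1 : Matrix (Config (FermionTorus 2 L) n) (Config (FermionTorus 2 L) n) ℂ)) := by
    rw [hsum, expect_pairField_doublonSum_eq_of_norm_eq hg _
      (w' := fun S => (n.factorial : ℂ) * pairSign S S) fun S _ => by
        rw [norm_mul, norm_mul, norm_prod_sign, norm_pairSign],
      ← hone, EtaPairingODLRO.expect_smul_vec, star_natCast, sq]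
  rw [h1, Complex.star_def, Complex.conj_ofReal, Complex.conj_mul']
  push_cast
  ring

end Tower

end Summit.HubbardSuperconductivity.HubbardSuperconductivity.Theorems.DWavePolarisedDiscordance.Negative

end
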